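import Summits.QuantumFields.YangMills.Theorems.SoloBlindTwoPointLogConvex
import HarnessLib

/-!
# The time-axis two-point sequence of a spatial plaquette (solo-QuantumFields-blind, rung D7⁺, part 4)

`T(t) = ⟨ψ_0 ψ_{t e₀}⟩_{Λ,β}`, `ψ_x = φ_{x;ij} − c`, as a function of `t : ZMod L` on the even torus: symmetry
`T(−t) = T(t)` (translation invariance + commutativity), identification of the reflected pairings of
parts 1–3 with values of `T` (`⟨ψ_{θy} ψ_{y + s e₀}⟩ = T(2y₀ − 1 + s)`), and hence, in sequence form,
NON-NEGATIVITY `0 ≤ T(2k+1)`, LOG-CONVEXITY `T(2k+1)² ≤ T(2k−1) T(2k+3)`, the torus symmetry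
`T(L − 1 − 2k) = T(2k+1)`, and hence MONOTONICITY: `T(2k+1) ≤ T(2j+1)` for `2j+1 ≤ 2k+1 ≤ L/2`
(`oddTwoPoint_antitone`; a discrete lemma on non-negative multiplicatively convex symmetric sequences)
— the complete finite-volume Källén–Lehmann shadow of link reflection positivity, for every `β ≥ 0`
and every compact `G`.  [folklore consequences of OS positivity; typed torus statements this unit's]
-/

open MeasureTheory
open Literature.MathematicalPhysics.QuantumFieldTheory Literature.RepresentationTheory.CompactGroups

noncomputable section

namespace Summit.QuantumFields.YangMills.Theorems.SoloBlind

section Sequence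

variable {d L N : ℕ} [NeZero d] [NeZero L] {G : Type*} [Group G] [TopologicalSpace G]
  [IsTopologicalGroup G] [CompactSpace G] [MeasurableSpace G] [BorelSpace G]
  (ρ : G →* Matrix (Fin N) (Fin N) ℂ)

/-- The time-axis two-point function of the shifted spatial plaquette `ψ = φ_{·;ij} − c`:
`T(t) = ⟨ψ_0 ψ_{t e₀}⟩_{Λ,β}`. -/
def twoPointT (β : ℝ) (i j : Fin d) (c : ℝ) (t : ZMod L) : ℝ :=
  wilsonExpectation ρ β fun U =>
    (plaquetteCost ρ (0 : Site d L) i j U - c) * (plaquetteCost ρ (Pi.single 0 t : Site d L) i j U - c)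

/-- **Symmetry** `T(−t) = T(t)` (translation by `t e₀` and commutativity of the product). -/
theorem twoPointT_neg (β : ℝ) (i j : Fin d) (c : ℝ) (t : ZMod L) :
    twoPointT ρ β i j c (-t) = twoPointT ρ β i j c t := by
  unfold twoPointT
  have key : (fun U : GaugeConfig d L G =>
      (plaquetteCost ρ (0 : Site d L) i j U - c) *
        (plaquetteCost ρ (Pi.single 0 (-t) : Site d L) i j U - c)) =
      (fun U => (plaquetteCost ρ (0 : Site d L) i j U - c) *
        (plaquetteCost ρ (Pi.single 0 t : Site d L) i j U - c)) ∘
        torusConfigShift (Pi.single 0 t : Site d L) := by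
    funext U
    simp only [Function.comp_apply, plaquetteCost, plaquetteHolonomy_torusConfigShift, zero_sub, sub_self,
      Pi.single_neg]
    ring
  rw [key, wilsonExpectation_comp_torusConfigShift]

omit [NeZero L] in
/-- Site identity: `(2y₀ − 1 + s) e₀ + θy = y + s e₀`. [folklore] -/
theorem single_add_timeReflect (y : Site d L) (s : ZMod L) :
    (Pi.single 0 (2 * y 0 - 1 + s) : Site d L) + y.timeReflect = y + Pi.single 0 s := by
  funext k
  by_cases hk : k = 0
  · subst hk
    simp only [Pi.add_apply, Pi.single_eq_same, Site.timeReflect, Function.update_self]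
    ring
  · simp [Pi.add_apply, Pi.single_eq_of_ne hk, Site.timeReflect, Function.update_of_ne hk]

/-- **The reflected pairings are values of `T`**: `⟨ψ_{θy} ψ_{y + s e₀}⟩ = T(2y₀ − 1 + s)`. -/
theorem twoPoint_eq_twoPointT (β : ℝ) (i j : Fin d) (c : ℝ) (y : Site d L) (s : ZMod L) :
    wilsonExpectation ρ β (fun U =>
        (plaquetteCost ρ y.timeReflect i j U - c) * (plaquetteCost ρ (y + Pi.single 0 s) i j U - c)) =
      twoPointT ρ β i j c (2 * y 0 - 1 + s) := by
  unfold twoPointT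
  have key : (fun U : GaugeConfig d L G =>
      (plaquetteCost ρ y.timeReflect i j U - c) * (plaquetteCost ρ (y + Pi.single 0 s) i j U - c)) =
      (fun U => (plaquetteCost ρ (0 : Site d L) i j U - c) *
        (plaquetteCost ρ (Pi.single 0 (2 * y 0 - 1 + s) : Site d L) i j U - c)) ∘
        torusConfigShift (-y.timeReflect) := by
    funext U
    simp only [Function.comp_apply, plaquetteCost, plaquetteHolonomy_torusConfigShift, sub_neg_eq_add,
      zero_add, single_add_timeReflect]
  rw [key, wilsonExpectation_comp_torusConfigShift]

/-- `⟨ψ_{θy} ψ_y⟩ = T(2y₀ − 1)`. -/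
theorem twoPoint_eq_twoPointT_zero (β : ℝ) (i j : Fin d) (c : ℝ) (y : Site d L) :
    wilsonExpectation ρ β (fun U =>
        (plaquetteCost ρ y.timeReflect i j U - c) * (plaquetteCost ρ y i j U - c)) =
      twoPointT ρ β i j c (2 * y 0 - 1) := by
  have h := twoPoint_eq_twoPointT ρ β i j c y 0
  simp only [Pi.single_zero, add_zero] at h
  exact h

/-- **Non-negativity in sequence form**: `0 ≤ T(2y₀ − 1)` for `1 ≤ y₀ ≤ L/2` (`β ≥ 0`, `L` even,
`i, j ≠ 0`). -/
theorem twoPointT_nonneg (hL : Even L) (hρ : Continuous ρ) {β : ℝ} (hβ : 0 ≤ β) {i j : Fin d}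
    (hi : i ≠ 0) (hj : j ≠ 0) (c : ℝ) (y : Site d L) (hy1 : 1 ≤ (y 0).val) (hy2 : (y 0).val ≤ L / 2) :
    0 ≤ twoPointT ρ β i j c (2 * y 0 - 1) := by
  rw [← twoPoint_eq_twoPointT_zero ρ β i j c y]
  exact wilsonExpectation_centred_twoPoint_nonneg ρ hL hρ hβ y hi hj hy1 hy2 c

/-- **Log-convexity in sequence form**: `T(2y₀ − 1 + s)² ≤ T(2y₀ − 1) · T(2z₀ − 1)`, `z = y + s e₀`,
both base points in the positive-time half. -/
theorem twoPointT_logConvex (hL : Even L) (hρ : Continuous ρ) {β : ℝ} (hβ : 0 ≤ β) {i j : Fin d}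
    (hi : i ≠ 0) (hj : j ≠ 0) (c : ℝ) (y : Site d L) (s : ZMod L)
    (hy1 : 1 ≤ (y 0).val) (hy2 : (y 0).val ≤ L / 2)
    (hz1 : 1 ≤ ((y + Pi.single 0 s : Site d L) 0).val)
    (hz2 : ((y + Pi.single 0 s : Site d L) 0).val ≤ L / 2) :
    (twoPointT ρ β i j c (2 * y 0 - 1 + s)) ^ 2 ≤
      twoPointT ρ β i j c (2 * y 0 - 1) * twoPointT ρ β i j c (2 * (y + Pi.single 0 s : Site d L) 0 - 1) := by
  have h3 := twoPoint_eq_twoPointT_zero ρ β i j c (y + Pi.single 0 s)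
  rw [← twoPoint_eq_twoPointT ρ β i j c y s, ← twoPoint_eq_twoPointT_zero ρ β i j c y, ← h3]
  exact wilsonExpectation_plaquette_twoPoint_logConvex ρ hL hρ hβ y s hi hj c hy1 hy2 hz1 hz2

end Sequence

/-! ### A discrete lemma: non-negative, multiplicatively midpoint-convex, symmetric sequences
decrease up to the middle -/

section Discrete

/-- Up-steps propagate to the right under `a (k+1)² ≤ a k · a (k+2)` and non-negativity. -/
theorem step_propagates {a : ℕ → ℝ} {K : ℕ} (h0 : ∀ k, k ≤ K → 0 ≤ a k)
    (hconv : ∀ k, k + 2 ≤ K → a (k + 1) ^ 2 ≤ a k * a (k + 2)) {k : ℕ} (hk : k + 2 ≤ K)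
    (hup : a k ≤ a (k + 1)) : a (k + 1) ≤ a (k + 2) := by
  have hc := hconv k hk
  rcases (h0 (k + 1) (by omega)).eq_or_lt with hz | hpos
  · rw [← hz]; exact h0 (k + 2) hk
  · have h1 : a (k + 1) * a (k + 1) ≤ a (k + 1) * a (k + 2) := by
      calc a (k + 1) * a (k + 1) = a (k + 1) ^ 2 := by ring
        _ ≤ a k * a (k + 2) := hc
        _ ≤ a (k + 1) * a (k + 2) := mul_le_mul_of_nonneg_right hup (h0 (k + 2) hk)
    exact le_of_mul_le_mul_left h1 hpos

/-- After an up-step at `l → l+1` the sequence is non-decreasing on `[l, K]`. -/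
theorem monotone_after_upstep {a : ℕ → ℝ} {K : ℕ} (h0 : ∀ k, k ≤ K → 0 ≤ a k)
    (hconv : ∀ k, k + 2 ≤ K → a (k + 1) ^ 2 ≤ a k * a (k + 2)) {l : ℕ} (hl : l + 1 ≤ K)
    (hup : a l ≤ a (l + 1)) : ∀ q, l ≤ q → q + 1 ≤ K → a q ≤ a (q + 1) := by
  intro q hlq hqK
  induction q with
  | zero =>
      have : l = 0 := by omega
      subst this; exact hup
  | succ q ih =>
      rcases Nat.eq_or_lt_of_le hlq with h | h
      · subst h; exact hup
      · have hq : a q ≤ a (q + 1) := ih (by omega) (by omega)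
        exact step_propagates h0 hconv (by omega) hq

/-- Chained form: non-decreasing between any two indices of `[l, K]` after an up-step at `l`. -/
theorem le_of_upstep {a : ℕ → ℝ} {K : ℕ} (h0 : ∀ k, k ≤ K → 0 ≤ a k)
    (hconv : ∀ k, k + 2 ≤ K → a (k + 1) ^ 2 ≤ a k * a (k + 2)) {l : ℕ} (hl : l + 1 ≤ K)
    (hup : a l ≤ a (l + 1)) : ∀ p q, l ≤ p → p ≤ q → q ≤ K → a p ≤ a q := by
  intro p q hlp hpq hqK
  induction q with
  | zero =>
      have : p = 0 := by omega
      subst this; exact le_rfl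
  | succ q ih =>
      rcases Nat.eq_or_lt_of_le hpq with h | h
      · subst h; exact le_rfl
      · exact (ih (by omega) (by omega)).trans
          (monotone_after_upstep h0 hconv hl hup q (by omega) hqK)

/-- **Discrete lemma.** A non-negative sequence on `[0, K]` with `a (k+1)² ≤ a k · a (k+2)` and the
symmetry `a (K − k) = a k` is non-increasing on `[0, K/2]`: `a k ≤ a j` for `j ≤ k`, `2k ≤ K`. -/
theorem antitone_of_mulConvex_symm {a : ℕ → ℝ} {K : ℕ} (h0 : ∀ k, k ≤ K → 0 ≤ a k)
    (hconv : ∀ k, k + 2 ≤ K → a (k + 1) ^ 2 ≤ a k * a (k + 2))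
    (hsymm : ∀ k, k ≤ K → a (K - k) = a k) {j k : ℕ} (hjk : j ≤ k) (hk : 2 * k ≤ K) :
    a k ≤ a j := by
  by_contra hlt
  push Not at hlt
  -- there is an up-step between j and k
  by_cases hchain : ∀ l, j ≤ l → l + 1 ≤ k → a (l + 1) ≤ a l
  · -- then a is non-increasing from j to k: contradiction
    have : ∀ q, j ≤ q → q ≤ k → a q ≤ a j := by
      intro q hjq hqk
      induction q with
      | zero =>
          have : j = 0 := by omega
          subst this; exact le_rfl
      | succ q ih =>
          rcases Nat.eq_or_lt_of_le hjq with h | h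
          · subst h; exact le_rfl
          · exact (hchain q (by omega) hqk).trans (ih (by omega) (by omega))
    exact absurd (this k hjk le_rfl) (not_le.mpr hlt)
  · push Not at hchain
    obtain ⟨l, hjl, hlk, hup⟩ := hchain
    have hmono := le_of_upstep h0 hconv (l := l) (by omega) hup.le
    have h1 : a k ≤ a (K - j) := hmono k (K - j) (by omega) (by omega) (by omega)
    rw [hsymm j (by omega)] at h1
    exact absurd h1 (not_le.mpr hlt)

end Discrete

/-! ### Monotonicity of the odd-separation two-point sequence -/

section Monotone

variable {d L N : ℕ} [NeZero d] [NeZero L] {G : Type*} [Group G] [TopologicalSpace G]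
  [IsTopologicalGroup G] [CompactSpace G] [MeasurableSpace G] [BorelSpace G]
  (ρ : G →* Matrix (Fin N) (Fin N) ℂ)

/-- The odd-separation sequence `a_k = T(2k+1)`. -/
def oddTwoPoint (β : ℝ) (i j : Fin d) (c : ℝ) (k : ℕ) : ℝ :=
  twoPointT (L := L) ρ β i j c ((2 * k + 1 : ℕ) : ZMod L)

/-- `0 ≤ a_k` for `k + 1 ≤ L/2`. -/
theorem oddTwoPoint_nonneg (hL : Even L) (hρ : Continuous ρ) {β : ℝ} (hβ : 0 ≤ β) {i j : Fin d}
    (hi : i ≠ 0) (hj : j ≠ 0) (c : ℝ) {k : ℕ} (hk : k + 1 ≤ L / 2) :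
    0 ≤ oddTwoPoint (L := L) ρ β i j c k := by
  set y : Site d L := Pi.single 0 ((k + 1 : ℕ) : ZMod L) with hy
  have hy0 : y 0 = ((k + 1 : ℕ) : ZMod L) := by simp [hy]
  have hval : (y 0).val = k + 1 := by rw [hy0]; exact ZMod.val_natCast_of_lt (by omega)
  have h := twoPointT_nonneg ρ hL hρ hβ hi hj c y (by omega) (by omega)
  have hidx : 2 * y 0 - 1 = ((2 * k + 1 : ℕ) : ZMod L) := by rw [hy0]; push_cast; ring
  rw [hidx] at h
  exact h

/-- `a_{k+1}² ≤ a_k · a_{k+2}` for `k + 3 ≤ L/2`. -/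
theorem oddTwoPoint_mulConvex (hL : Even L) (hρ : Continuous ρ) {β : ℝ} (hβ : 0 ≤ β) {i j : Fin d}
    (hi : i ≠ 0) (hj : j ≠ 0) (c : ℝ) {k : ℕ} (hk : k + 3 ≤ L / 2) :
    oddTwoPoint (L := L) ρ β i j c (k + 1) ^ 2 ≤
      oddTwoPoint (L := L) ρ β i j c k * oddTwoPoint (L := L) ρ β i j c (k + 2) := by
  set y : Site d L := Pi.single 0 ((k + 1 : ℕ) : ZMod L) with hy
  have hy0 : y 0 = ((k + 1 : ℕ) : ZMod L) := by simp [hy]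
  have hz0 : (y + Pi.single 0 (2 : ZMod L) : Site d L) 0 = ((k + 3 : ℕ) : ZMod L) := by
    rw [Pi.add_apply, hy0, Pi.single_eq_same]; push_cast; ring
  have hvaly : (y 0).val = k + 1 := by rw [hy0]; exact ZMod.val_natCast_of_lt (by omega)
  have hvalz : ((y + Pi.single 0 (2 : ZMod L) : Site d L) 0).val = k + 3 := by
    rw [hz0]; exact ZMod.val_natCast_of_lt (by omega)
  have h := twoPointT_logConvex ρ hL hρ hβ hi hj c y 2 (by omega) (by omega) (by omega) (by omega)
  have h1 : 2 * y 0 - 1 + 2 = ((2 * (k + 1) + 1 : ℕ) : ZMod L) := by rw [hy0]; push_cast; ring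
  have h2 : 2 * y 0 - 1 = ((2 * k + 1 : ℕ) : ZMod L) := by rw [hy0]; push_cast; ring
  have h3 : 2 * (y + Pi.single 0 (2 : ZMod L) : Site d L) 0 - 1 = ((2 * (k + 2) + 1 : ℕ) : ZMod L) := by
    rw [hz0]; push_cast; ring
  rw [h1, h2, h3] at h
  exact h

/-- Symmetry `a_{K−k} = a_k`, `K = L/2 − 1` (the torus seen the other way round). -/
theorem oddTwoPoint_symm (hL : Even L) (β : ℝ) (i j : Fin d) (c : ℝ) {k : ℕ} (hk : k ≤ L / 2 - 1) :
    oddTwoPoint (L := L) ρ β i j c (L / 2 - 1 - k) = oddTwoPoint (L := L) ρ β i j c k := by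
  have hL0 : L ≠ 0 := NeZero.ne L
  obtain ⟨r, hr⟩ := hL
  have hsum : 2 * (L / 2 - 1 - k) + 1 + (2 * k + 1) = L := by omega
  have hneg : ((2 * (L / 2 - 1 - k) + 1 : ℕ) : ZMod L) = -((2 * k + 1 : ℕ) : ZMod L) := by
    rw [eq_neg_iff_add_eq_zero, ← Nat.cast_add, hsum, ZMod.natCast_self]
  unfold oddTwoPoint
  rw [hneg, twoPointT_neg]

/-- **Monotonicity of the connected two-point function at odd separations** (rung D7⁺, part 4).
For `β ≥ 0`, `L` even, `i, j ≠ 0`, any constant `c`, and odd separations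
`2j+1 ≤ 2k+1 ≤ L/2`: `T(2k+1) ≤ T(2j+1)` — the (connected) correlation of two parallel spatial
plaquettes is non-increasing in the odd time separation up to half the torus. -/
theorem oddTwoPoint_antitone (hL : Even L) (hρ : Continuous ρ) {β : ℝ} (hβ : 0 ≤ β) {i j : Fin d}
    (hi : i ≠ 0) (hj : j ≠ 0) (c : ℝ) {j' k : ℕ} (hjk : j' ≤ k) (hk : 2 * k ≤ L / 2 - 1) :
    oddTwoPoint (L := L) ρ β i j c k ≤ oddTwoPoint (L := L) ρ β i j c j' := by
  have hL2 : 2 ≤ L := by obtain ⟨r, hr⟩ := hL; have := NeZero.ne L; omega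
  refine antitone_of_mulConvex_symm (K := L / 2 - 1) (a := oddTwoPoint (L := L) ρ β i j c)
    (fun k hk => oddTwoPoint_nonneg ρ hL hρ hβ hi hj c (by omega))
    (fun k hk => oddTwoPoint_mulConvex ρ hL hρ hβ hi hj c (by omega))
    (fun k hk => oddTwoPoint_symm ρ hL β i j c hk) hjk hk

end Monotone

end Summit.QuantumFields.YangMills.Theorems.SoloBlind

end
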